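import Summits.NavierStokesRegularity.NavierStokesRegularity.Theorems.ScalingDefectPeepholeDoorTubeDefect

/-!
# ScalingDefectPeepholeDoorTubeAssembly — door S30 «ScalingDefectPeepholeDoor» v2 (nsreg-p1 g24 ROUND-28 v2 6cf1a9889313ec10),
# plate P2 = K1ω `VortexDefectTubeBound`: THE ASSEMBLY MODULO THE WINDOW-FIELD EXTENSION

`vortexDefectTubeBound_of_windowExtension` — K1ω BY NAME from ONE remaining input, spelled out as a hypothesis (no new `def`):
the WINDOW-FIELD TUBE EXTENSION «for `C_u` and `A ≥ 1` there are `δ₀ > 0`, `K₀ ≥ 0` and, for every `C_p`, a lateness `T₁ ∈ (0,1]` such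
that for every Pineau–Vicol-class solution and every `t̄ ∈ (−T₁, 0)` the window field `physWindowField 0 0 u t̄ = √(−t̄) u(t̄, √(−t̄)·)`
has a holomorphic extension to `localComplexTube 0 (A+1) δ₀` bounded by `K₀`» (= Bradshaw–Grujić–Kukavica 2015 Thm 2.3 with the bound
of its scheme, tree `bradshawGrujicKukavica2015_local_analyticity_radius_supBound`, instantiated on a late parabolic window of the
Type-I class — part T3, open).  Given it, parts T1/T2a/T2b (`exists_vortexDefect_extension`) produce the vorticity-defect extension with
class constants, and the window field is `C³` on `B(0, A+1)` by the lateness `√(−t̄)(A+1) < 1` (classical smoothness of the slice).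

Door S30 is a regularity CRITERION inside a HYPOTHETICAL local Type-I blow-up (item 0056 `NoTypeII` stays OPEN); nothing here bears on
NS regularity itself.
-/

noncomputable section

set_option linter.dupNamespace false

namespace Summit.NavierStokesRegularity.NavierStokesRegularity.Theorems.ScalingDefectPeepholeDoor

open MeasureTheory Set Function Filter Metric TopologicalSpace Complex
open scoped Topology ContDiff ENNReal
open Literature.Analysis Literature.Analysis.FluidPDE Literature.Analysis.Complex
open Literature.Analysis.FunctionSpaces.EuclideanSpace (complexify norm_complexify complexify_apply)
open Summit.NavierStokesRegularity.NavierStokesRegularity.Theorems.StableStrataDoorDefs (physWindowField)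

/-- **The window field of a classical solution is `C³` on `B(0, A+1)` once `√(−t̄)(A+1) ≤ 1`.** -/
theorem contDiffOn_physWindowField {u : ℝ → EuclideanSpace ℝ (Fin 3) → EuclideanSpace ℝ (Fin 3)}
    {p : ℝ → EuclideanSpace ℝ (Fin 3) → ℝ}
    (hreg : IsClassicalNSSolutionOnRegion (Ico (-1 : ℝ) 0 ×ˢ ball (0 : EuclideanSpace ℝ (Fin 3)) 1) 1 0 u p)
    {tb A : ℝ} (htb1 : -1 < tb) (htb0 : tb < 0) (hA : Real.sqrt (-tb) * (A + 1) ≤ 1) :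
    ContDiffOn ℝ 3 (physWindowField 0 0 u tb) (ball (0 : EuclideanSpace ℝ (Fin 3)) (A + 1)) := by
  have hc : 0 < Real.sqrt (-tb) := Real.sqrt_pos.2 (by linarith)
  have hsec : spaceSection (Ico (-1 : ℝ) 0 ×ˢ ball (0 : EuclideanSpace ℝ (Fin 3)) 1) tb = ball 0 1 :=
    spaceSection_prod (show tb ∈ Ico (-1 : ℝ) 0 from ⟨htb1.le, htb0⟩) _
  have hu : ContDiffOn ℝ 3 (u tb) (ball (0 : EuclideanSpace ℝ (Fin 3)) 1) := by
    have h := hreg.contDiffOn_velocity tb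
    rw [hsec] at h
    exact (contDiffOn_infty.1 h) 3
  have e : physWindowField 0 0 u tb = fun y => Real.sqrt (-tb) • u tb (Real.sqrt (-tb) • y) := by
    funext y; simp only [physWindowField, zero_sub, zero_add]
  rw [e]
  have hmaps : MapsTo (fun y : EuclideanSpace ℝ (Fin 3) => Real.sqrt (-tb) • y)
      (ball (0 : EuclideanSpace ℝ (Fin 3)) (A + 1)) (ball (0 : EuclideanSpace ℝ (Fin 3)) 1) := by
    intro y hy
    rw [mem_ball_zero_iff] at hy ⊢
    rw [norm_smul, Real.norm_of_nonneg hc.le]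
    calc Real.sqrt (-tb) * ‖y‖ < Real.sqrt (-tb) * (A + 1) := mul_lt_mul_of_pos_left hy hc
      _ ≤ 1 := hA
  exact (hu.comp (contDiff_id.const_smul (Real.sqrt (-tb))).contDiffOn hmaps).const_smul (Real.sqrt (-tb))

/-- **K1ω `VortexDefectTubeBound` from the window-field tube extension** (the one remaining input of plate P2, part T3), via
`exists_vortexDefect_extension` (parts T1/T2a/T2b) and `contDiffOn_physWindowField`. -/
theorem vortexDefectTubeBound_of_windowExtension
    (hWin : ∀ Cu : ℝ, 0 < Cu → ∀ A : ℝ, 1 ≤ A → ∃ δ₀ K₀ : ℝ, 0 < δ₀ ∧ 0 ≤ K₀ ∧ ∀ Cp : ℝ, 0 < Cp →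
      ∃ T₁ : ℝ, 0 < T₁ ∧ T₁ ≤ 1 ∧
      ∀ (u : ℝ → EuclideanSpace ℝ (Fin 3) → EuclideanSpace ℝ (Fin 3)) (p : ℝ → EuclideanSpace ℝ (Fin 3) → ℝ),
        IsClassicalNSSolutionOnRegion
          (Ico (-1 : ℝ) 0 ×ˢ ball (0 : EuclideanSpace ℝ (Fin 3)) 1) 1 0 u p →
        (∀ t ∈ Ico (-1 : ℝ) 0, ∀ x ∈ ball (0 : EuclideanSpace ℝ (Fin 3)) 1,
          ‖u t x‖ ≤ Cu / (Real.sqrt (-t) + ‖x‖)) →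
        (∀ t ∈ Ico (-1 : ℝ) 0, ∀ x : EuclideanSpace ℝ (Fin 3), 1 / 2 < ‖x‖ → ‖x‖ < 3 / 4 → |p t x| ≤ Cp) →
        ∀ tb ∈ Ioo (-T₁) 0,
          ∃ U : EuclideanSpace ℂ (Fin 3) → EuclideanSpace ℂ (Fin 3),
            DifferentiableOn ℂ U (localComplexTube (0 : EuclideanSpace ℝ (Fin 3)) (A + 1) δ₀) ∧
            (∀ z ∈ localComplexTube (0 : EuclideanSpace ℝ (Fin 3)) (A + 1) δ₀, ‖U z‖ ≤ K₀) ∧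
            ∀ y ∈ ball (0 : EuclideanSpace ℝ (Fin 3)) (A + 1),
              U (complexify y) = complexify (physWindowField 0 0 u tb y)) :
    VortexDefectTubeBound := by
  intro Cu hCu A hA
  obtain ⟨δ₀, K₀, hδ₀, hK₀, hT⟩ := hWin Cu hCu A hA
  obtain ⟨δ, K, hδ, hK, hF⟩ := exists_vortexDefect_extension A δ₀ K₀ hA hδ₀ hK₀
  refine ⟨δ, hδ, K, hK, fun Cp hCp => ?_⟩
  obtain ⟨T₁, hT₁, hT₁1, hsol⟩ := hT Cp hCp
  have hA1 : 0 < A + 1 := by linarith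
  set T₂ : ℝ := min T₁ (1 / (A + 1) ^ 2) with hT₂_def
  have hT₂ : 0 < T₂ := lt_min hT₁ (by positivity)
  refine ⟨T₂, hT₂, (min_le_left _ _).trans hT₁1, fun u p hreg hI hP tb htb => ?_⟩
  have htbT₁ : tb ∈ Ioo (-T₁) 0 := ⟨lt_of_le_of_lt (neg_le_neg (min_le_left _ _)) htb.1, htb.2⟩
  have htb1 : -1 < tb := by linarith [htbT₁.1]
  obtain ⟨U, hU, hUb, hUW⟩ := hsol u p hreg hI hP tb htbT₁
  -- lateness ⇒ `√(−t̄)(A+1) ≤ 1`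
  have hlate : Real.sqrt (-tb) * (A + 1) ≤ 1 := by
    have h1 : -tb < 1 / (A + 1) ^ 2 := by
      have := min_le_right T₁ (1 / (A + 1) ^ 2); linarith [htb.1]
    have h2 : Real.sqrt (-tb) ≤ 1 / (A + 1) := by
      rw [← Real.sqrt_sq (by positivity : (0 : ℝ) ≤ 1 / (A + 1))]
      exact Real.sqrt_le_sqrt (by rw [div_pow, one_pow]; exact h1.le)
    calc Real.sqrt (-tb) * (A + 1) ≤ 1 / (A + 1) * (A + 1) := mul_le_mul_of_nonneg_right h2 hA1.le
      _ = 1 := by field_simp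
  exact hF U _ hU hUb (contDiffOn_physWindowField hreg htb1 htb.2 hlate) hUW

/-! ## Two measure-theoretic helpers for part T3 -/

/-- `L^q` norm on a set of finite measure from a pointwise bound: `‖f‖_{L^q(S)} ≤ |S|^{1/q} C`. -/
theorem eLpNorm_restrict_le_of_forall_norm_le {F : Type*} [NormedAddCommGroup F] {f : EuclideanSpace ℝ (Fin 3) → F}
    {S : Set (EuclideanSpace ℝ (Fin 3))} (hS : MeasurableSet S) (hSfin : volume S < ⊤) {C q : ℝ} (hq : 0 < q)
    (h : ∀ x ∈ S, ‖f x‖ ≤ C) :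
    eLpNorm f (ENNReal.ofReal q) (volume.restrict S) ≤ ENNReal.ofReal ((volume S).toReal ^ (1 / q) * C) := by
  have hae : ∀ᵐ x ∂(volume.restrict S), ‖f x‖ ≤ C := by
    filter_upwards [ae_restrict_mem hS] with x hx using h x hx
  refine (eLpNorm_le_of_ae_bound hae).trans (le_of_eq ?_)
  rw [Measure.restrict_apply_univ, ENNReal.toReal_ofReal hq.le, ENNReal.ofReal_mul (by positivity),
    ← ENNReal.ofReal_toReal hSfin.ne, ENNReal.ofReal_rpow_of_nonneg ENNReal.toReal_nonneg (by positivity),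
    ENNReal.toReal_ofReal ENNReal.toReal_nonneg, one_div]

/-- the `c`-bookkeeping of the zoomed pressure level: `c² · (c³)^{−1/2} · (c²/2)^{−1/4} = 2^{1/4} ≤ 2` (`c > 0`). -/
theorem zoom_pressure_level_le {c : ℝ} (hc : 0 < c) :
    c ^ 2 * ((c ^ 3)⁻¹) ^ (1 / 2 : ℝ) * (c ^ 2 / 2) ^ (-(1 / 4 : ℝ)) ≤ 2 := by
  have e1 : ((c ^ 3)⁻¹) ^ (1 / 2 : ℝ) = c ^ (-(3 / 2 : ℝ)) := by
    rw [Real.inv_rpow (by positivity), ← Real.rpow_natCast c 3, ← Real.rpow_mul hc.le, Real.rpow_neg hc.le]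
    norm_num
  have e2 : (c ^ 2 / 2) ^ (-(1 / 4 : ℝ)) = c ^ (-(1 / 2 : ℝ)) * (2 : ℝ) ^ ((1 / 4 : ℝ)) := by
    rw [div_eq_mul_inv, Real.mul_rpow (by positivity) (by positivity), ← Real.rpow_natCast c 2,
      ← Real.rpow_mul hc.le, Real.inv_rpow (by norm_num), Real.rpow_neg (by norm_num : (0 : ℝ) ≤ 2), inv_inv]
    norm_num
  have e3 : c ^ 2 * c ^ (-(3 / 2 : ℝ)) * c ^ (-(1 / 2 : ℝ)) = 1 := by
    rw [← Real.rpow_natCast c 2, ← Real.rpow_add hc, ← Real.rpow_add hc]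
    norm_num
  have e4 : (2 : ℝ) ^ ((1 / 4 : ℝ)) ≤ 2 := by
    calc (2 : ℝ) ^ ((1 / 4 : ℝ)) ≤ (2 : ℝ) ^ (1 : ℝ) := Real.rpow_le_rpow_of_exponent_le (by norm_num) (by norm_num)
      _ = 2 := Real.rpow_one _
  calc c ^ 2 * ((c ^ 3)⁻¹) ^ (1 / 2 : ℝ) * (c ^ 2 / 2) ^ (-(1 / 4 : ℝ))
      = (c ^ 2 * c ^ (-(3 / 2 : ℝ)) * c ^ (-(1 / 2 : ℝ))) * (2 : ℝ) ^ ((1 / 4 : ℝ)) := by rw [e1, e2]; ring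
    _ ≤ 2 := by rw [e3, one_mul]; exact e4


end Summit.NavierStokesRegularity.NavierStokesRegularity.Theorems.ScalingDefectPeepholeDoor

end
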